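import Summits.Ventures.HSemireg.ObstructionLocusTorus

/-!
# Venture HSemireg — (S5) OBSTRUCTION LOCUS away from secant type, III′: CRITERION A for an ARBITRARY disjoint
# arrangement of coordinate sub-torus translates (any number of components, every `N`)

HONEST FRAMING.  Sequel of `ObstructionLocusTorus.lean` (cell `pub-hsemireg`, track «S4-PUSH» (ii), seat s4-prove-2): the
two-component statements there (`sumElim_blochTarget_injective`, `finrank_ker_pair_of_near`) extended to a disjoint
arrangement `Z = ⊔_c B_{S c}` indexed by any finite type.  Finite combinatorics / linear algebra only; sign-free (arbitrary
non-zero signs `ε`); nothing here says that HC / HC_CM / HC_AV holds; REGIME A is class-dead (file III docstring).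

* `arrangementTarget_injective_iff` — **CRITERION A** (G2-DEFORM-SANITY C.1, «[T from the closed forms]»): for pairwise
  DISTINCT types, the target assignment of Bloch's `π_Z` is injective iff no two types form a near pair
  (`S_c ∖ k = S_{c'} ∖ k'`; for equal sizes `⟺ |S_c △ S_{c'}| = 2`, `near_iff_card_symmDiff`), i.e. iff
  `|S_c △ S_{c'}| ≥ 4` for all `c ≠ c'` in the equal-codimension setting.
* `finrank_ker_arrangement_of_far` (`= 0`: semiregular) / `finrank_ker_arrangement_pos_of_near` (`> 0`: not) — the
  kernel form, whatever the signs.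
-/

open scoped BigOperators
open Finset

namespace Summit.Ventures.HSemireg.ObstructionLocus

variable {K : Type*} [Field K]


section Arrangement

variable {N : ℕ} {ι : Type*} (S : ι → Finset (Fin N))

/-- Near-pair bookkeeping: if `S ∖ k = S' ∖ k'` with `S ≠ S'`, then `k ≠ k'`, `k' ∉ S`, `k ∉ S'`. -/
theorem near_aux {S S' : Finset (Fin N)} (hSS' : S ≠ S') {k k' : Fin N} (hk : k ∈ S) (hk' : k' ∈ S')
    (he : S.erase k = S'.erase k') : k ≠ k' ∧ k' ∉ S ∧ k ∉ S' := by
  have hkk : k ≠ k' := by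
    rintro rfl; apply hSS'; rw [← Finset.insert_erase hk, he, Finset.insert_erase hk']
  refine ⟨hkk, fun h => ?_, fun h => ?_⟩
  · have : k' ∈ S.erase k := Finset.mem_erase.2 ⟨Ne.symm hkk, h⟩
    rw [he] at this; exact Finset.notMem_erase k' S' this
  · have : k ∈ S'.erase k' := Finset.mem_erase.2 ⟨hkk, h⟩
    rw [← he] at this; exact Finset.notMem_erase k S this

/-- Bloch's `π` on the disjoint arrangement `Z = ⊔_c B_{S c}`: the target monomial of the basis vector `(c; i, k)`. -/
def arrangementTarget (x : Σ c, BlochIndex (S c)) : Finset (Fin N) × Finset (Fin N) := blochTarget (S x.1) x.2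

/-- **CRITERION A (G2-DEFORM-SANITY C.1), every `N`, any number of components.**  For a disjoint arrangement of coordinate
sub-torus translates of pairwise DISTINCT types, the target assignment of `π_Z` is injective iff NO two types form a
near pair (`S_c ∖ k = S_{c'} ∖ k'`; for equal sizes: iff `|S_c △ S_{c'}| ≥ 4` for all `c ≠ c'`, `near_iff_card_symmDiff`). -/
theorem arrangementTarget_injective_iff (hdist : ∀ c c', c ≠ c' → S c ≠ S c') :
    Function.Injective (arrangementTarget S) ↔
      ∀ c c', c ≠ c' → ¬ ∃ k ∈ S c, ∃ k' ∈ S c', (S c).erase k = (S c').erase k' := by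
  constructor
  · intro hinj c c' hcc' ⟨k, hk, k', hk', he⟩
    obtain ⟨-, hk'S, hkS'⟩ := near_aux (hdist c c' hcc') hk hk' he
    let p : BlochIndex (S c) := ⟨(k', k), hk'S, hk⟩
    let q : BlochIndex (S c') := ⟨(k, k'), hkS', hk'⟩
    have heq : arrangementTarget S ⟨c, p⟩ = arrangementTarget S ⟨c', q⟩ :=
      (blochTarget_eq_iff (hdist c c' hcc') p q).2 ⟨rfl, rfl, he⟩
    have := congr_arg Sigma.fst (hinj heq)
    exact hcc' this
  · rintro hfar ⟨c, p⟩ ⟨c', q⟩ h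
    by_cases hcc' : c = c'
    · subst hcc'
      have := blochTarget_injective (S c) h
      subst this; rfl
    · exfalso
      obtain ⟨-, -, he⟩ := (blochTarget_eq_iff (hdist c c' hcc') p q).1 h
      exact hfar c c' hcc' ⟨p.1.2, p.2.2, q.1.2, q.2.2, he⟩

variable [Fintype ι] [DecidableEq ι]

/-- CRITERION A, kernel form: no near pair ⟹ `π_Z` has trivial kernel (semiregular), whatever the signs. -/
theorem finrank_ker_arrangement_of_far (hdist : ∀ c c', c ≠ c' → S c ≠ S c')
    (hfar : ∀ c c', c ≠ c' → ¬ ∃ k ∈ S c, ∃ k' ∈ S c', (S c).erase k = (S c').erase k')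
    {ε : (Σ c, BlochIndex (S c)) → K} (hε : ∀ j, ε j ≠ 0) :
    Module.finrank K (LinearMap.ker (monomialMap (arrangementTarget S) ε)) = 0 :=
  finrank_ker_monomialMap_of_injective ((arrangementTarget_injective_iff S hdist).2 hfar) hε

/-- CRITERION A, converse: one near pair ⟹ `π_Z` has a kernel (NOT semiregular), whatever the signs. -/
theorem finrank_ker_arrangement_pos_of_near (hdist : ∀ c c', c ≠ c' → S c ≠ S c')
    {c c' : ι} (hcc' : c ≠ c') (hnear : ∃ k ∈ S c, ∃ k' ∈ S c', (S c).erase k = (S c').erase k')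
    {ε : (Σ c, BlochIndex (S c)) → K} (hε : ∀ j, ε j ≠ 0) :
    0 < Module.finrank K (LinearMap.ker (monomialMap (arrangementTarget S) ε)) := by
  have h := finrank_ker_monomialMap (arrangementTarget S) hε
  have hnotinj : ¬ Function.Injective (arrangementTarget S) := fun hinj =>
    (arrangementTarget_injective_iff S hdist).1 hinj c c' hcc' hnear
  have hlt : (Finset.univ.image (arrangementTarget S)).card < Fintype.card (Σ c, BlochIndex (S c)) := by
    rw [← Finset.card_univ]
    refine lt_of_le_of_ne Finset.card_image_le fun heq => hnotinj ?_
    have hinjOn := Finset.injOn_of_card_image_eq heq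
    intro x y hxy
    exact hinjOn (Finset.mem_univ x) (Finset.mem_univ y) hxy
  omega

end Arrangement

end Summit.Ventures.HSemireg.ObstructionLocus
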